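import Mathlib
import Literature.NumberTheory.LFunctions.Zhang2022.Section13Rem137
import Literature.NumberTheory.LFunctions.Zhang2022.Section13C137
import HarnessLib

/-!
# Zhang (2022) §13 (13.7): the h137 BYPASS EDGE at the named constant `c137` —
# `Eq1311Rel c′ c137 → Eval137Rel c′` from Proposition 2.2, and for all large `c′` with NO hypothesis

Topic `Literature/NumberTheory/LFunctions/Zhang2022` (Landau–Siegel audit tree; verdict-neutral).
Y. Zhang, *Discrete mean estimates and the Landau–Siegel zero*, arXiv:2211.02515v1 (2022)
[Zhang2022LandauSiegel], §13 (13.7), (13.11) p. 75 — an unrefereed manuscript under adjudication; nothing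
here asserts or denies its Theorems 1–2. Lane ZHANG-L (WP14), rulings R-19 (DISCHARGE-BY-BYPASS of the
leaf `Skeleton.Eq137 c′ c₀`) and R-21 (named-constant form, `Typed.Section13.c137`).

Composition only (WP14-PLAN W14-R2a(2)): zl-w14-p5's edge-with-remainder-hypothesis
`eval137Rel_of_1311Rel_of_rem` (`Section13C137`, the tree theorem `eval137Rel_of_repaired` at its own
witness `c137`) ∘ the remainder estimate `rem137_of_prop22` / `rem137_eventually` (`Section13Rem137`,
PROVED):

* `eval137Rel_of_1311Rel_of_prop22` — `0 ≤ c′ → Prop22 c′ → Eq1311Rel c′ c137 → Eval137Rel c′`;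
* `eval137Rel_of_1311Rel` — **`∃ k, ∀ c′ ≥ k, Eq1311Rel c′ c137 → Eval137Rel c′`, no hypothesis**
  (Prop. 2.2 is a tree theorem for large `c′`): the edge the skeleton pen threads in place of
  `eval137Rel_of h137 h1311` (v19 l.279), dropping the binder `h137`.

Theorems only: no new definition, no new fact, axioms standard.

## References

* Y. Zhang, arXiv:2211.02515v1 (2022), §13 (13.7), (13.11) p. 75. [cite: Zhang2022LandauSiegel, §13 p.75]
-/

noncomputable section

namespace Literature.NumberTheory.LFunctions.Zhang2022.Typed.Section13

open Skeleton

/-- **The bypass edge from Proposition 2.2** (R-19/R-21): for `c′ ≥ 0` with `Skeleton.Prop22 c′`, the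
relative (13.11) at the named constant, `Skeleton.Eq1311Rel c′ c137`, implies the consumed node
`Skeleton.Eval137Rel c′` — `eval137Rel_of_1311Rel_of_rem` ∘ `rem137_of_prop22`.
[cite: Zhang2022LandauSiegel, §13 (13.7), (13.11) p.75] -/
theorem eval137Rel_of_1311Rel_of_prop22 {c' : ℝ} (hc' : 0 ≤ c') (h22 : Prop22 c')
    (h1311 : Eq1311Rel c' c137) : Eval137Rel c' :=
  eval137Rel_of_1311Rel_of_rem c' h1311 (rem137_of_prop22 hc' h22)

/-- **The h137 bypass edge, threshold form, NO hypothesis**: there is `k` such that for every `c′ ≥ k`,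
`Skeleton.Eq1311Rel c′ c137 → Skeleton.Eval137Rel c′` (`Skeleton.prop22_eventually` supplies Prop. 2.2
for large `c′`). With the leaf closer `∀ c′ ≥ k′, Eq1311Rel c′ c137` this yields `Eval137Rel c′` for all
large `c′`, which is all the whole-DAG theorem consumes of §13.
[cite: Zhang2022LandauSiegel, §13 (13.7), (13.11) p.75] -/
theorem eval137Rel_of_1311Rel : ∃ k : ℝ, ∀ c' : ℝ, k ≤ c' → Eq1311Rel c' c137 → Eval137Rel c' := by
  obtain ⟨c₀, hc₀, h⟩ := prop22_eventually
  exact ⟨c₀, fun c' hc' h1311 => eval137Rel_of_1311Rel_of_prop22 (hc₀.trans hc') (h c' hc') h1311⟩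

end Literature.NumberTheory.LFunctions.Zhang2022.Typed.Section13

end
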